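import Literature.Analysis.ODE.TorusFlowGradCompInv
import Mathlib.Analysis.Calculus.InverseFunctionTheorem.FDeriv
import HarnessLib

/-!
# Smoothness of the inverse flow on the torus, and Armstrong–Vicol App. A Prop. 7.10 (second display)

Analysis/ODE proof file (theorems only; no definitions, no named facts). Let `f : ℝ × T^d → ℝ^d` be
jointly smooth and divergence free, `X(t) = id + proj ∘ D(t)` its flow (`D` jointly smooth, `D(0) = 0`,
`∂ₜD = f∘X`), and let `Xinv(t)` be ANY two-sided inverse of `X(t)` (pointwise identities
`Xinv(t, X(t,x)) = x`, `X(t, Xinv(t,y)) = y`). We prove that `Xinv` is automatically of the form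
`Xinv(t,y) = y + proj Dinv(t,y)` with a jointly smooth inverse displacement `Dinv`
(`exists_smooth_inverse_displacement`): the lifted space–time flow map
`Ψ(t,v) = (t, v + D(t, proj v))` is a smooth bijection of `ℝ × ℝ^d` (bijectivity of `X(t)` on the torus
lifts, §1) whose derivative is everywhere invertible (`det(1 + ∇D) = 1` by incompressibility,
`TorusFlow.det_flowGrad_eq_one`), hence an open map (inverse function theorem,
`HasStrictFDerivAt.map_nhds_eq_of_equiv`), hence a homeomorphism with smooth inverse
(`Homeomorph.contDiff_symm`); the inverse displacement `Ψ⁻¹(t,w).2 − w` is `ℤ^d`-periodic and descends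
to the torus (§2).

Consequently the tree's named fact **`Torus.ArmstrongVicol2025_flowGrad_comp_inv`** (Armstrong–Vicol,
App. A Prop. 7.10, second display: `max_{n<N} ⟦(∇X)(t, X⁻¹(t,·))⟧_{n, R_f(1+4|t|dC_fR_f)²} ≤ (d−1)!(20d)^{d−1}`)
is DISCHARGED as typed: `Torus.ArmstrongVicol2025_flowGrad_comp_inv_holds` (§3), by
`TorusFlow.flowGrad_comp_inv_of_regularInverse` (file `TorusFlowGradCompInv`).

## References

* S. Armstrong, V. Vicol, *Anomalous diffusion by fractal homogenization*, Ann. PDE 11 (2025),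
  arXiv:2305.05048, App. A Prop. 7.10 and its proof, p. 73. [`ArmstrongVicol2025`]
* A. J. Majda, A. L. Bertozzi, *Vorticity and Incompressible Flow* (CUP 2002), §1.3 (the particle
  trajectory map of a smooth incompressible field is a diffeomorphism with `J ≡ 1`). [`MajdaBertozziCUP2002`]
-/

noncomputable section

open Set Filter Topology Function Matrix
open scoped ContDiff

namespace Literature.Analysis.ODE

namespace TorusFlow

open Literature.Analysis.FunctionSpaces Literature.Analysis.FunctionSpaces.Torus Literature.Analysis.Calculus

variable {d : Type*} [Fintype d] [DecidableEq d]

/-! ## §1 The lifted flow map `v ↦ v + E(proj v)` is a bijection of `ℝ^d` -/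

section Lift

variable {E : UnitAddTorus d → EuclideanSpace ℝ d} {Xi : UnitAddTorus d → UnitAddTorus d}

omit [Fintype d] [DecidableEq d] in
/-- `proj (v + E(proj v)) = X(proj v)`. [folklore] -/
private theorem proj_add_lift (E : UnitAddTorus d → EuclideanSpace ℝ d) (v : EuclideanSpace ℝ d) :
    proj (v + lift E v) = proj v + proj (E (proj v)) := rfl

/-- `ℤ^d`-periodicity of lifts. [folklore] -/
private theorem lift_add_latticeVec' (E : UnitAddTorus d → EuclideanSpace ℝ d) (v : EuclideanSpace ℝ d)
    (k : d → ℤ) : lift E (v + latticeVec k) = lift E v :=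
  congrArg E (proj_add_latticeVec v k)

/-- `latticeVec (−k) = −latticeVec k`. [folklore] -/
private theorem latticeVec_neg' (k : d → ℤ) : latticeVec (d := d) (-k) = -latticeVec k := by
  ext i
  simp [latticeVec_apply]

omit [Fintype d] [DecidableEq d] in
/-- If `X = id + proj∘E` has a left inverse on the torus, its lift `v ↦ v + E(proj v)` is injective.
[folklore] -/
private theorem liftFlow_injective (hXi₁ : ∀ x, Xi (x + proj (E x)) = x) :
    Function.Injective (fun v : EuclideanSpace ℝ d => v + lift E v) := by
  intro v w h
  have hp : proj v = proj w := by
    have h1 : proj (v + lift E v) = proj (w + lift E w) := congrArg proj h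
    rw [proj_add_lift, proj_add_lift] at h1
    have := congrArg Xi h1
    rwa [hXi₁, hXi₁] at this
  have hE : lift E v = lift E w := by
    show E (proj v) = E (proj w)
    rw [hp]
  have h' : v + lift E v = w + lift E w := h
  rw [hE] at h'
  exact add_right_cancel h'

/-- If `X = id + proj∘E` has a right inverse on the torus, its lift `v ↦ v + E(proj v)` is surjective.
[folklore] -/
private theorem liftFlow_surjective (hXi₂ : ∀ y, Xi y + proj (E (Xi y)) = y) :
    Function.Surjective (fun v : EuclideanSpace ℝ d => v + lift E v) := by
  intro w
  obtain ⟨u, hu⟩ := proj_surjective (Xi (proj w))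
  have hpu : proj (u + lift E u) = proj w := by
    rw [proj_add_lift, hu]
    exact hXi₂ (proj w)
  obtain ⟨k, hk⟩ := (proj_eq_proj_iff_holds w (u + lift E u)).1 hpu.symm
  refine ⟨u - latticeVec k, ?_⟩
  have hper : lift E (u - latticeVec k) = lift E u := by
    rw [sub_eq_add_neg, ← latticeVec_neg', lift_add_latticeVec']
  show u - latticeVec k + lift E (u - latticeVec k) = w
  rw [hper]
  calc u - latticeVec k + lift E u = (u + lift E u) - latticeVec k := by abel
    _ = w := by rw [hk]; abel

end Lift

/-! ## §2 The inverse flow has a jointly smooth displacement -/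

variable {f D : ℝ → UnitAddTorus d → EuclideanSpace ℝ d}

/-- The derivative of the lift `v ↦ v + D(t, proj v)` in the direction `h` is `(1 + ∇D(t, proj v)) h`,
componentwise. [folklore] -/
private theorem add_fderiv_apply_eq_mulVec {u : UnitAddTorus d → EuclideanSpace ℝ d} (hu : IsContDiff 1 u)
    (x : UnitAddTorus d) (h : EuclideanSpace ℝ d) (i : d) :
    (h + Torus.fderiv u x h) i =
      ((Matrix.of fun i j => (1 : Matrix d d ℝ) i j + partialDeriv j (fun z => u z i) x) *ᵥ
        (fun j => h j)) i := by
  have hsum : (Torus.fderiv u x h) i = ∑ j, h j * partialDeriv j (fun z => u z i) x := by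
    rw [fderiv_apply_eq_sum_partialDeriv hu, WithLp.ofLp_sum, Finset.sum_apply]
    refine Finset.sum_congr rfl fun j _ => ?_
    rw [WithLp.ofLp_smul, Pi.smul_apply, smul_eq_mul, partialDeriv_apply_coord hu]
  rw [PiLp.add_apply, hsum, Matrix.mulVec, dotProduct]
  simp only [Matrix.of_apply, add_mul, Finset.sum_add_distrib, Matrix.one_apply, ite_mul, one_mul,
    zero_mul, Finset.sum_ite_eq, Finset.mem_univ, if_true]
  congr 1
  exact Finset.sum_congr rfl fun j _ => mul_comm _ _

/-- **The inverse of the flow of a smooth divergence-free field is `id +` a jointly smooth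
displacement.** If `Xinv(t)` is a two-sided inverse of `X(t) = id + proj∘D(t)` for every `t`, then
`Xinv(t,y) = y + proj Dinv(t,y)` for some jointly smooth `Dinv : ℝ × T^d → ℝ^d` (inverse function
theorem for the lifted space–time map `(t,v) ↦ (t, v + D(t, proj v))`, whose Jacobian determinant is
`det(1 + ∇D) = 1`). [cite: MajdaBertozziCUP2002, §1.3 (particle-trajectory map is a diffeomorphism)] -/
theorem exists_smooth_inverse_displacement (hf : IsSmoothSpaceTimeOn univ f) (hD : IsSmoothSpaceTimeOn univ D)
    (hdiv : ∀ t, IsDivFree (f t)) (hD0 : ∀ x, D 0 x = 0)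
    (hODE : ∀ t x, HasDerivAt (fun s => D s x) (f t (x + proj (D t x))) t)
    {Xinv : ℝ → UnitAddTorus d → UnitAddTorus d}
    (hinv₁ : ∀ t x, Xinv t (x + proj (D t x)) = x) (hinv₂ : ∀ t y, Xinv t y + proj (D t (Xinv t y)) = y) :
    ∃ Dinv : ℝ → UnitAddTorus d → EuclideanSpace ℝ d,
      IsSmoothSpaceTimeOn univ Dinv ∧ ∀ t y, Xinv t y = y + proj (Dinv t y) := by
  -- the lifted space–time flow map `Ψ(t,v) = (t, v + D(t, proj v))`
  set Ψ : ℝ × EuclideanSpace ℝ d → ℝ × EuclideanSpace ℝ d := fun p => (p.1, p.2 + stLift D p) with hΨ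
  have hcdD : ContDiff ℝ ∞ (stLift D) := by
    have h := hD
    unfold IsSmoothSpaceTimeOn at h
    rwa [univ_prod_univ, contDiffOn_univ] at h
  have hcdΨ : ContDiff ℝ ∞ Ψ := contDiff_fst.prodMk (contDiff_snd.add hcdD)
  have hderD : ∀ p, HasFDerivAt (stLift D) (_root_.fderiv ℝ (stLift D) p) p := fun p =>
    ((hcdD.differentiable (by simp)) p).hasFDerivAt
  -- its derivative `L p (s,h) = (s, h + D(stLift D)(p)(s,h))`
  set L : ℝ × EuclideanSpace ℝ d → (ℝ × EuclideanSpace ℝ d →L[ℝ] ℝ × EuclideanSpace ℝ d) := fun p =>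
    (ContinuousLinearMap.fst ℝ ℝ (EuclideanSpace ℝ d)).prod
      (ContinuousLinearMap.snd ℝ ℝ (EuclideanSpace ℝ d) + _root_.fderiv ℝ (stLift D) p) with hL
  have hLΨ : ∀ p, HasFDerivAt Ψ (L p) p := fun p => hasFDerivAt_fst.prodMk (hasFDerivAt_snd.add (hderD p))
  -- the space part of `D(stLift D)` is the torus derivative of the slice
  have hsp : ∀ (t : ℝ) (v h : EuclideanSpace ℝ d),
      _root_.fderiv ℝ (stLift D) (t, v) ((0 : ℝ), h) = Torus.fderiv (D t) (proj v) h := by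
    intro t v h
    have hc : HasFDerivAt (lift (D t))
        ((_root_.fderiv ℝ (stLift D) (t, v)).comp (ContinuousLinearMap.inr ℝ ℝ (EuclideanSpace ℝ d))) v :=
      (hderD (t, v)).comp v (hasFDerivAt_prodMk_right t v)
    rw [← fderiv_lift, hc.fderiv, ContinuousLinearMap.comp_apply, ContinuousLinearMap.inr_apply]
  -- `L p` is injective: `det(1 + ∇D) = 1`
  have hD1 : ∀ t, IsContDiff 1 (D t) := fun t => (hD.isSmooth_slice (mem_univ t)).isContDiff (by simp)
  have hLinj : ∀ p, Function.Injective (L p) := by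
    rintro ⟨t, v⟩
    refine (injective_iff_map_eq_zero (L (t, v))).2 fun q hq => ?_
    obtain ⟨s, h⟩ := q
    have h1 : s = 0 := by
      have := congrArg Prod.fst hq
      simpa [hL] using this
    subst h1
    have h2 : h + _root_.fderiv ℝ (stLift D) (t, v) ((0 : ℝ), h) = 0 := by
      have := congrArg Prod.snd hq
      simpa [hL] using this
    rw [hsp] at h2
    have hunit : IsUnit (Matrix.of fun i j => (1 : Matrix d d ℝ) i j + partialDeriv j (fun z => D t z i) (proj v)) := by
      rw [Matrix.isUnit_iff_isUnit_det, det_flowGrad_eq_one hf hD hD0 hODE hdiv t (proj v)]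
      exact isUnit_one
    have hinj := Matrix.mulVec_injective_iff_isUnit.2 hunit
    have hvec : (Matrix.of fun i j => (1 : Matrix d d ℝ) i j + partialDeriv j (fun z => D t z i) (proj v)) *ᵥ
        (fun j => h j) = (Matrix.of fun i j => (1 : Matrix d d ℝ) i j + partialDeriv j (fun z => D t z i) (proj v)) *ᵥ 0 := by
      rw [Matrix.mulVec_zero]
      funext i
      rw [← add_fderiv_apply_eq_mulVec (hD1 t) (proj v) h i, h2]
      rfl
    have h0 : (fun j => h j) = 0 := hinj hvec
    have hh : h = 0 := by
      ext j
      exact congrFun h0 j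
    rw [hh]
    rfl
  -- so it is a continuous linear equivalence
  have hCLE : ∀ p, ∃ e : (ℝ × EuclideanSpace ℝ d) ≃L[ℝ] (ℝ × EuclideanSpace ℝ d),
      (e : ℝ × EuclideanSpace ℝ d →L[ℝ] ℝ × EuclideanSpace ℝ d) = L p := fun p =>
    ⟨(LinearEquiv.ofInjectiveEndo (L p).toLinearMap (hLinj p)).toContinuousLinearEquiv,
      ContinuousLinearMap.ext fun q => rfl⟩
  choose e he using hCLE
  have hLΨ' : ∀ p, HasFDerivAt Ψ (e p : ℝ × EuclideanSpace ℝ d →L[ℝ] ℝ × EuclideanSpace ℝ d) p := fun p => by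
    rw [he]
    exact hLΨ p
  -- `Ψ` is open (inverse function theorem) and bijective, hence a homeomorphism with smooth inverse
  have hopen : IsOpenMap Ψ := isOpenMap_iff_nhds_le.2 fun p =>
    ((hcdΨ.contDiffAt.hasStrictFDerivAt' (hLΨ' p) (by simp)).map_nhds_eq_of_equiv).ge
  have hbij : Function.Bijective Ψ := by
    constructor
    · rintro ⟨t, v⟩ ⟨s, w⟩ h
      have h1 : t = s := congrArg Prod.fst h
      subst h1
      have h2 : v + lift (D t) v = w + lift (D t) w := congrArg Prod.snd h
      exact Prod.ext rfl (liftFlow_injective (hinv₁ t) h2)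
    · rintro ⟨t, w⟩
      obtain ⟨v, hv⟩ := liftFlow_surjective (hinv₂ t) w
      exact ⟨(t, v), Prod.ext rfl hv⟩
  set H : (ℝ × EuclideanSpace ℝ d) ≃ₜ (ℝ × EuclideanSpace ℝ d) :=
    (Equiv.ofBijective Ψ hbij).toHomeomorphOfContinuousOpen hcdΨ.continuous hopen with hH
  have hHΨ : (H : ℝ × EuclideanSpace ℝ d → ℝ × EuclideanSpace ℝ d) = Ψ := rfl
  have hGcd : ContDiff ℝ ∞ (H.symm : ℝ × EuclideanSpace ℝ d → ℝ × EuclideanSpace ℝ d) :=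
    H.contDiff_symm (f₀' := e) (fun a => by rw [hHΨ]; exact hLΨ' a) hcdΨ
  set G : ℝ × EuclideanSpace ℝ d → ℝ × EuclideanSpace ℝ d := fun q => H.symm q with hG
  have hΨG : ∀ q, Ψ (G q) = q := fun q => H.apply_symm_apply q
  have hG1 : ∀ q, (G q).1 = q.1 := fun q => by
    have h := congrArg Prod.fst (hΨG q)
    exact h
  have hG2 : ∀ (t : ℝ) (w : EuclideanSpace ℝ d), (G (t, w)).2 + lift (D t) (G (t, w)).2 = w := by
    intro t w
    have h2 : (G (t, w)).2 + stLift D (G (t, w)) = w := congrArg Prod.snd (hΨG (t, w))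
    have h1 : (G (t, w)).1 = t := hG1 (t, w)
    have e1 : stLift D (G (t, w)) = lift (D t) (G (t, w)).2 := by
      show D (G (t, w)).1 (proj (G (t, w)).2) = D t (proj (G (t, w)).2)
      rw [h1]
    rwa [e1] at h2
  -- `ℤ^d`-equivariance of the inverse
  have hper : ∀ (t : ℝ) (w : EuclideanSpace ℝ d) (k : d → ℤ),
      (G (t, w + latticeVec k)).2 = (G (t, w)).2 + latticeVec k := by
    intro t w k
    apply liftFlow_injective (hinv₁ t)
    show (G (t, w + latticeVec k)).2 + lift (D t) (G (t, w + latticeVec k)).2 =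
      (G (t, w)).2 + latticeVec k + lift (D t) ((G (t, w)).2 + latticeVec k)
    rw [hG2, lift_add_latticeVec', add_right_comm, hG2]
  -- the inverse displacement, descended to the torus through the section `repr`
  have hrepr : ∀ w : EuclideanSpace ℝ d, ∃ k : d → ℤ, repr (proj w) = w + latticeVec k := fun w =>
    (proj_eq_proj_iff_holds w (repr (proj w))).1 (by rw [proj_repr])
  have hDw : ∀ (t : ℝ) (w : EuclideanSpace ℝ d),
      (G (t, repr (proj w))).2 - repr (proj w) = (G (t, w)).2 - w := by
    intro t w
    obtain ⟨k, hk⟩ := hrepr w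
    rw [hk, hper]
    abel
  refine ⟨fun t y => (G (t, repr y)).2 - repr y, ?_, ?_⟩
  · -- joint smoothness: the space–time lift is `q ↦ (G q).2 − q.2`
    have hst : stLift (fun t y => (G (t, repr y)).2 - repr y) =
        fun q : ℝ × EuclideanSpace ℝ d => (G q).2 - q.2 := by
      funext q
      obtain ⟨t, w⟩ := q
      exact hDw t w
    refine isSmoothSpaceTimeOn_of_contDiff ?_ univ
    rw [hst]
    exact (contDiff_snd.comp hGcd).sub contDiff_snd
  · intro t y
    obtain ⟨w, rfl⟩ := proj_surjective y
    have e1 : (G (t, repr (proj w))).2 - repr (proj w) = (G (t, w)).2 - w := hDw t w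
    show Xinv t (proj w) = proj w + proj ((G (t, repr (proj w))).2 - repr (proj w))
    rw [e1, ← proj_add, add_sub_cancel]
    -- `Xinv t (proj w) = proj (G(t,w)).2` since `X(t, proj (G(t,w)).2) = proj w`
    have h2 := hG2 t w
    have h3 : proj w = proj (G (t, w)).2 + proj (D t (proj (G (t, w)).2)) := by
      rw [← proj_add_lift, h2]
    rw [h3, hinv₁]

end TorusFlow

end Literature.Analysis.ODE

/-! ## §3 Discharge of the named fact `Torus.ArmstrongVicol2025_flowGrad_comp_inv` -/

namespace Literature.Analysis.FunctionSpaces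

namespace Torus

open Literature.Analysis.ODE.TorusFlow

/-- **Armstrong–Vicol, App. A Prop. 7.10 (second display) — DISCHARGED**: for the flow `X = id + proj∘D`
of a jointly smooth divergence-free `f` with `max_{1≤n≤N} sup_t ⟦f(t)⟧_{n,R_f} ≤ C_f` and ANY two-sided
inverse `Xinv(t)` of `X(t)`, for `n + 1 ≤ N`, `|t| ≤ 1/(4dC_fR_f)` and all `i, j`,
`⟦δᵢⱼ + ∂ⱼDᵢ(t, Xinv(t,·))⟧_{n, R_f(1+4|t|dC_fR_f)²} ≤ (d−1)! (20d)^{d−1}`. Proof: the inverse is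
automatically `id +` a jointly smooth displacement (`TorusFlow.exists_smooth_inverse_displacement`), and
then `TorusFlow.flowGrad_comp_inv_of_regularInverse` (transport equation of `X⁻¹ − id`, Cor. 7.8,
`(∇X)∘X⁻¹ = adj(∇X⁻¹)`, Lemma 7.1) applies.
[cite: ArmstrongVicol2025, App. A Prop. 7.10 (arXiv §7.3 p. 73, second display)] -/
theorem ArmstrongVicol2025_flowGrad_comp_inv_holds :
    ∀ (d : Type*) [Fintype d] [DecidableEq d], ArmstrongVicol2025_flowGrad_comp_inv d := by
  intro d _ _ N f D Xinv Cf Rf hCf hRf hf hD hdiv hD0 hODE hinv₁ hinv₂ hfb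
  obtain ⟨Dinv, hDinv, hXinv⟩ := exists_smooth_inverse_displacement hf hD hdiv hD0 hODE hinv₁ hinv₂
  exact flowGrad_comp_inv_of_regularInverse N f D Xinv Cf Rf hCf hRf hf hD hdiv hD0 hODE hinv₁ hinv₂ hfb
    hDinv hXinv

end Torus

end Literature.Analysis.FunctionSpaces

end
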